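import Summits.FinalStateConjecture.FinalStateConjecture.Theorems.EIHFluxBalanceLLShellFormula
import Mathlib.Analysis.Calculus.ParametricIntegral

/-!
# Route EIHFluxBalance — `LLBalanceLaw` (iv): calculus of surface integrals over round spheres

Helper file for the support item `stmt-FinalStateConjecture-10189`
(`Summit.FinalStateConjecture.FinalStateConjecture.Theses.EIHFluxBalance.LLBalanceLaw`), clause (iv)
(`dP^μ/dt = −flux`). Everything about `∮_{|y−ξ|=ρ} f dμHE[2]` is pulled back, through the translated
spherical parametrisation `y = ξ + ρ σ₁(θ, φ)` and the area formula of
`EIHFluxBalanceLLSphericalChart`, to the box `(0, π) × (−π, π)` with Lebesgue measure, where the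
standard parametric-integral theorems apply:

* `setIntegral_sphere_center` — the centred-at-`ξ` area formula;
* `continuousAt_setIntegral_sphere` — `ρ ↦ ∮_{|y−ξ|=ρ} G dμHE[2]` is continuous at `R` for `G`
  continuous near the sphere (dominated convergence on the box);
* `hasDerivAt_setIntegral_sphere` — differentiation under `∮` in an external parameter for a
  jointly `C¹` integrand (`hasDerivAt_integral_of_dominated_loc_of_deriv_le` on the box).
-/

noncomputable section

open MeasureTheory MeasureTheory.Measure Set Function Filter Metric Module Real
open scoped Topology ENNReal

namespace Summit.FinalStateConjecture.FinalStateConjecture.Theorems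

namespace LLSphere

open Literature.Geometry.Lorentzian

local notation "E2" => EuclideanSpace ℝ (Fin 2)

local notation "sphUnit" => (fun p : EuclideanSpace ℝ (Fin 2) ↦
  (WithLp.toLp 2 ![sin (p 0) * cos (p 1), sin (p 0) * sin (p 1), cos (p 0)] : E3))

local notation "sphJacCLM" => (fun p : EuclideanSpace ℝ (Fin 2) ↦
  LinearMap.toContinuousLinearMap
    (Matrix.toLpLin 2 2 ((fun p : EuclideanSpace ℝ (Fin 2) ↦
      (!![cos (p 0) * cos (p 1), -(sin (p 0) * sin (p 1));
          cos (p 0) * sin (p 1), sin (p 0) * cos (p 1);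
          -sin (p 0), 0] : Matrix (Fin 3) (Fin 2) ℝ)) p) : EuclideanSpace ℝ (Fin 2) →ₗ[ℝ] E3))

local notation "sphBox" =>
  (setOf fun p : EuclideanSpace ℝ (Fin 2) ↦ p 0 ∈ Ioo 0 π ∧ p 1 ∈ Ioo (-π) π)

/-! ### Spheres about a general centre -/

/-- **Area formula on the sphere of radius `ρ > 0` about `ξ`**:
`∮_{|y−ξ|=ρ} f dμHE[2] = ∫_{(0,π)×(−π,π)} ρ² sin θ · f(ξ + ρ σ₁(θ, φ)) d(θ, φ)` (translation invariance
of `μHE[2]` and `setIntegral_sphere_eq_setIntegral_sphBox`). [cite: Federer1969, 3.2.5] -/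
theorem setIntegral_sphere_center (ξ : E3) {ρ : ℝ} (hρ : 0 < ρ) (f : E3 → ℝ) :
    ∫ y in sphere ξ ρ, f y ∂(μHE[2] : Measure E3) =
      ∫ p in sphBox, (ρ ^ 2 * sin (p 0)) * f (ξ + ρ • sphUnit p) := by
  rw [setIntegral_eq_setIntegral_preimage_add_left (μHE[2] : Measure E3) ξ f,
    preimage_add_left_sphere, setIntegral_sphere_eq_setIntegral_sphBox hρ]

/-- The parameter box has finite Lebesgue measure. [folklore] -/
theorem volume_sphBox_lt_top : volume sphBox < ∞ := by
  refine lt_of_le_of_lt (measure_mono ?_) (isCompact_closedBall (0 : E2) (π + π)).measure_lt_top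
  intro p hp
  rw [mem_closedBall_zero_iff, EuclideanSpace.norm_eq, Fin.sum_univ_two]
  have h0 : ‖p 0‖ ^ 2 ≤ π ^ 2 := by
    rw [Real.norm_eq_abs, sq_abs]
    nlinarith [hp.1.1, hp.1.2]
  have h1 : ‖p 1‖ ^ 2 ≤ π ^ 2 := by
    rw [Real.norm_eq_abs, sq_abs]
    nlinarith [hp.2.1, hp.2.2]
  calc √(‖p 0‖ ^ 2 + ‖p 1‖ ^ 2) ≤ √((π + π) ^ 2) :=
        Real.sqrt_le_sqrt (by nlinarith [Real.pi_pos])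
    _ = π + π := Real.sqrt_sq (by linarith [Real.pi_pos])

/-- The translated spherical map lands on the sphere. [folklore] -/
theorem add_smul_sphUnit_mem_sphere (ξ : E3) {ρ : ℝ} (hρ : 0 ≤ ρ) (p : E2) :
    ξ + ρ • sphUnit p ∈ sphere ξ ρ := by
  rw [mem_sphere, dist_eq_norm, add_sub_cancel_left]
  exact mem_sphere_zero_iff_norm.mp (sphMap_mem_sphere hρ p)

/-- The translated spherical map is continuous in the parameters. [folklore] -/
theorem continuous_add_smul_sphUnit (ξ : E3) (ρ : ℝ) :
    Continuous fun p : E2 ↦ ξ + ρ • sphUnit p := by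
  have h : Continuous sphUnit :=
    continuous_iff_continuousAt.mpr fun p ↦ (hasFDerivAt_sphUnit p).continuousAt
  exact continuous_const.add (h.const_smul ρ)

/-! ### A closed shell around a sphere inside an open set -/

/-- **Compactness margin**: if the sphere `{|y − ξ| = R}`, `R > 0`, lies in the open set `V`, then so
does a closed shell `{R − δ ≤ |y − ξ| ≤ R + δ}` with `0 < δ < R`. [folklore] -/
theorem exists_closedShell_subset {V : Set E3} (hV : IsOpen V) {ξ : E3} {R : ℝ} (hR : 0 < R)
    (hsub : sphere ξ R ⊆ V) :
    ∃ δ : ℝ, 0 < δ ∧ δ < R ∧ {y : E3 | R - δ ≤ dist y ξ ∧ dist y ξ ≤ R + δ} ⊆ V := by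
  obtain ⟨δ₀, hδ₀, hthick⟩ := (isCompact_sphere ξ R).exists_cthickening_subset_open hV hsub
  refine ⟨min δ₀ (R / 2), lt_min hδ₀ (by linarith), (min_le_right _ _).trans_lt (by linarith),
    fun y hy ↦ hthick ?_⟩
  have hy0 : 0 < dist y ξ := by
    have := min_le_right δ₀ (R / 2)
    linarith [hy.1]
  have hyξ : y - ξ ≠ 0 := by
    rw [dist_eq_norm] at hy0
    exact norm_pos_iff.mp hy0
  -- the radial projection of `y` onto the sphere
  set z : E3 := ξ + (R / ‖y - ξ‖) • (y - ξ) with hz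
  have hzmem : z ∈ sphere ξ R := by
    rw [mem_sphere, dist_eq_norm, hz, add_sub_cancel_left, norm_smul, norm_div, Real.norm_of_nonneg
      hR.le, norm_norm, div_mul_cancel₀ _ (norm_ne_zero_iff.mpr hyξ)]
  refine Metric.mem_cthickening_of_dist_le y z δ₀ (sphere ξ R) hzmem ?_
  have hdist : dist y z = |dist y ξ - R| := by
    rw [dist_eq_norm, dist_eq_norm, hz, show y - (ξ + (R / ‖y - ξ‖) • (y - ξ)) =
      (1 - R / ‖y - ξ‖) • (y - ξ) by rw [sub_smul, one_smul]; abel, norm_smul, Real.norm_eq_abs]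
    rw [show (1 - R / ‖y - ξ‖) = (‖y - ξ‖ - R) / ‖y - ξ‖ by
      field_simp [norm_ne_zero_iff.mpr hyξ], abs_div, abs_of_pos (norm_pos_iff.mpr hyξ),
      div_mul_cancel₀ _ (norm_ne_zero_iff.mpr hyξ)]
  rw [hdist]
  have h1 := min_le_left δ₀ (R / 2)
  rw [abs_le]
  constructor <;> linarith [hy.1, hy.2]

/-- Points `ξ + ρ σ₁(p)` with `ρ` in `[R − δ, R + δ]` lie in the closed shell. [folklore] -/
theorem add_smul_sphUnit_mem_closedShell (ξ : E3) {R δ ρ : ℝ} (hρ0 : 0 ≤ ρ)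
    (hρ : R - δ ≤ ρ ∧ ρ ≤ R + δ) (p : E2) :
    ξ + ρ • sphUnit p ∈ {y : E3 | R - δ ≤ dist y ξ ∧ dist y ξ ≤ R + δ} := by
  have h := add_smul_sphUnit_mem_sphere ξ hρ0 p
  rw [mem_sphere] at h
  show R - δ ≤ dist (ξ + ρ • sphUnit p) ξ ∧ dist (ξ + ρ • sphUnit p) ξ ≤ R + δ
  rw [h]
  exact hρ

/-- The closed shell is compact. [folklore] -/
theorem isCompact_closedShell (ξ : E3) (R δ : ℝ) :
    IsCompact {y : E3 | R - δ ≤ dist y ξ ∧ dist y ξ ≤ R + δ} := by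
  refine (isCompact_closedBall ξ (R + δ)).of_isClosed_subset ?_ fun y hy ↦ mem_closedBall.mpr hy.2
  exact (isClosed_le continuous_const (continuous_id.dist continuous_const)).inter
    (isClosed_le (continuous_id.dist continuous_const) continuous_const)

/-! ### Continuity of sphere integrals in the radius -/

/-- **`ρ ↦ ∮_{|y−ξ|=ρ} G dμHE[2]` is continuous at `R > 0`** when `G` is continuous on an open set
containing the sphere of radius `R`: on the box the integrand `ρ² sin θ · G(ξ + ρ σ₁)` is
continuous in `ρ` and uniformly bounded for `ρ` near `R` (dominated convergence). [folklore] -/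
theorem continuousAt_setIntegral_sphere {V : Set E3} (hV : IsOpen V) {G : E3 → ℝ}
    (hG : ContinuousOn G V) {ξ : E3} {R : ℝ} (hR : 0 < R) (hsub : sphere ξ R ⊆ V) :
    ContinuousAt (fun ρ ↦ ∫ y in sphere ξ ρ, G y ∂(μHE[2] : Measure E3)) R := by
  obtain ⟨δ, hδ, hδR, hshell⟩ := exists_closedShell_subset hV hR hsub
  obtain ⟨M, hM⟩ := (isCompact_closedShell ξ R δ).exists_bound_of_continuousOn (hG.mono hshell)
  have hI : Ioo (R - δ) (R + δ) ∈ 𝓝 R := Ioo_mem_nhds (by linarith) (by linarith)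
  -- the box integral is continuous at `R`
  have hbox : ContinuousAt (fun ρ ↦ ∫ p in sphBox, (ρ ^ 2 * sin (p 0)) * G (ξ + ρ • sphUnit p)) R := by
    refine continuousAt_of_dominated (bound := fun _ ↦ (R + δ) ^ 2 * M) ?_ ?_ ?_ ?_
    · filter_upwards [hI] with ρ hρ
      refine (Continuous.continuousOn ?_).aestronglyMeasurable measurableSet_sphBox
      refine (continuous_const.mul (Real.continuous_sin.comp
        (EuclideanSpace.proj (𝕜 := ℝ) (0 : Fin 2)).continuous)).mul ?_
      refine (hG.mono hshell).comp_continuous (continuous_add_smul_sphUnit ξ ρ) fun p ↦ ?_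
      exact add_smul_sphUnit_mem_closedShell ξ (by linarith [hρ.1]) ⟨hρ.1.le, hρ.2.le⟩ p
    · filter_upwards [hI] with ρ hρ
      refine (ae_restrict_iff' measurableSet_sphBox).mpr (Eventually.of_forall fun p _ ↦ ?_)
      rw [norm_mul]
      have hρ0 : 0 ≤ ρ := by linarith [hρ.1]
      have h1 : ‖ρ ^ 2 * sin (p 0)‖ ≤ (R + δ) ^ 2 := by
        rw [Real.norm_eq_abs, abs_mul, abs_of_nonneg (sq_nonneg ρ)]
        calc ρ ^ 2 * |sin (p 0)| ≤ ρ ^ 2 := mul_le_of_le_one_right (sq_nonneg ρ) (abs_sin_le_one _)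
          _ ≤ (R + δ) ^ 2 := pow_le_pow_left₀ hρ0 hρ.2.le 2
      exact mul_le_mul h1 (hM _ (add_smul_sphUnit_mem_closedShell ξ hρ0 ⟨hρ.1.le, hρ.2.le⟩ p))
        (norm_nonneg _) (by positivity)
    · exact integrableOn_const volume_sphBox_lt_top.ne
    · refine (ae_restrict_iff' measurableSet_sphBox).mpr (Eventually.of_forall fun p _ ↦ ?_)
      refine ((continuous_id.pow 2).mul continuous_const).continuousAt.mul ?_
      have hy : ξ + R • sphUnit p ∈ V := hsub (add_smul_sphUnit_mem_sphere ξ hR.le p)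
      have hGc : ContinuousAt G (ξ + R • sphUnit p) := hG.continuousAt (hV.mem_nhds hy)
      have hpathc : ContinuousAt (fun ρ : ℝ ↦ ξ + ρ • sphUnit p) R :=
        (continuous_const.add (continuous_id.smul continuous_const)).continuousAt
      exact ContinuousAt.comp (f := fun ρ : ℝ ↦ ξ + ρ • sphUnit p) hGc hpathc
  -- and it agrees with the sphere integral near `R`
  refine hbox.congr (f := fun ρ ↦ ∫ p in sphBox, (ρ ^ 2 * sin (p 0)) * G (ξ + ρ • sphUnit p)) ?_
  filter_upwards [hI] with ρ hρ
  exact (setIntegral_sphere_center ξ (by linarith [hρ.1]) G).symm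

/-! ### Differentiation under the sphere integral -/

/-- **Differentiation under `∮_{|y−ξ|=R}` in an external parameter**: if `(s, y) ↦ K s y` is `C¹`
on an open set `W ⊇ {t} × {|y − ξ| = R}` (`R > 0`), then `s ↦ ∮ K s dμHE[2]` is differentiable at
`t` with derivative `∮ ∂_s K t dμHE[2]` (parametric differentiation on the box, the `s`-derivative
being dominated uniformly near `t` by compactness). [folklore] -/
theorem hasDerivAt_setIntegral_sphere {K : ℝ → E3 → ℝ} {W : Set (ℝ × E3)} (hW : IsOpen W)
    (hK : ContDiffOn ℝ 1 (Function.uncurry K) W) {ξ : E3} {R t : ℝ} (hR : 0 < R)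
    (hsub : ∀ y ∈ sphere ξ R, (t, y) ∈ W) :
    HasDerivAt (fun s ↦ ∫ y in sphere ξ R, K s y ∂(μHE[2] : Measure E3))
      (∫ y in sphere ξ R, fderiv ℝ (Function.uncurry K) (t, y) (1, 0) ∂(μHE[2] : Measure E3)) t := by
  -- a product neighbourhood `u × v ⊆ W` of `{t} × sphere`, and a closed ball of times inside `u`
  have hprod : ({t} : Set ℝ) ×ˢ sphere ξ R ⊆ W := by
    rintro ⟨s, y⟩ ⟨h1, h2⟩
    have h1' : s = t := mem_singleton_iff.mp h1
    rw [h1']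
    exact hsub y h2
  obtain ⟨u, v, hu, -, htu, hsv, huv⟩ := generalized_tube_lemma isCompact_singleton
    (isCompact_sphere ξ R) hW hprod
  have htu' : t ∈ u := htu rfl
  obtain ⟨ε, hε, hballu⟩ := Metric.isOpen_iff.mp hu t htu'
  have hcb : closedBall t (ε / 2) ⊆ u := (closedBall_subset_ball (by linarith)).trans hballu
  have hKc : ContinuousOn (Function.uncurry K) W := hK.continuousOn
  have hdKc : ContinuousOn (fderiv ℝ (Function.uncurry K)) W :=
    hK.continuousOn_fderiv_of_isOpen hW le_rfl
  have hcptW : closedBall t (ε / 2) ×ˢ sphere ξ R ⊆ W := (prod_mono hcb hsv).trans huv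
  obtain ⟨M, hM⟩ := ((isCompact_closedBall t (ε / 2)).prod (isCompact_sphere ξ R))
    |>.exists_bound_of_continuousOn (hdKc.mono hcptW)
  have hM0 : 0 ≤ M := (norm_nonneg _).trans
    (hM (t, ξ + R • sphUnit (0 : E2))
      ⟨mem_closedBall_self (by linarith), add_smul_sphUnit_mem_sphere ξ hR.le (0 : E2)⟩)
  have hmemW : ∀ s ∈ ball t (ε / 2), ∀ p : E2, (s, ξ + R • sphUnit p) ∈ W := fun s hs p ↦
    hcptW ⟨ball_subset_closedBall hs, add_smul_sphUnit_mem_sphere ξ hR.le p⟩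
  have hball : ball t (ε / 2) ∈ 𝓝 t := ball_mem_nhds t (by linarith)
  -- continuity of the box integrands
  have hFc : ∀ s ∈ ball t (ε / 2),
      Continuous fun p : E2 ↦ (R ^ 2 * sin (p 0)) * K s (ξ + R • sphUnit p) := by
    intro s hs
    refine (continuous_const.mul (Real.continuous_sin.comp
      (EuclideanSpace.proj (𝕜 := ℝ) (0 : Fin 2)).continuous)).mul ?_
    exact hKc.comp_continuous (f := fun p : E2 ↦ (s, ξ + R • sphUnit p))
      (continuous_const.prodMk (continuous_add_smul_sphUnit ξ R)) fun p ↦ hmemW s hs p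
  have hF'c : Continuous fun p : E2 ↦
      (R ^ 2 * sin (p 0)) * fderiv ℝ (Function.uncurry K) (t, ξ + R • sphUnit p) (1, 0) := by
    refine (continuous_const.mul (Real.continuous_sin.comp
      (EuclideanSpace.proj (𝕜 := ℝ) (0 : Fin 2)).continuous)).mul ?_
    have h1 : Continuous fun p : E2 ↦ fderiv ℝ (Function.uncurry K) (t, ξ + R • sphUnit p) :=
      hdKc.comp_continuous (f := fun p : E2 ↦ (t, ξ + R • sphUnit p))
        (continuous_const.prodMk (continuous_add_smul_sphUnit ξ R))
        fun p ↦ hmemW t (mem_ball_self (by linarith)) p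
    exact h1.clm_apply continuous_const
  -- the scalar weight is bounded by `R²`
  have hw : ∀ p : E2, ‖R ^ 2 * sin (p 0)‖ ≤ R ^ 2 := fun p ↦ by
    rw [Real.norm_eq_abs, abs_mul, abs_of_nonneg (sq_nonneg R)]
    exact mul_le_of_le_one_right (sq_nonneg R) (abs_sin_le_one _)
  -- hypotheses of the parametric differentiation theorem
  have hmeas : ∀ᶠ s in 𝓝 t, AEStronglyMeasurable
      (fun p : E2 ↦ (R ^ 2 * sin (p 0)) * K s (ξ + R • sphUnit p)) (volume.restrict sphBox) := by
    filter_upwards [hball] with s hs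
    exact (hFc s hs).aestronglyMeasurable
  have hint : Integrable (fun p : E2 ↦ (R ^ 2 * sin (p 0)) * K t (ξ + R • sphUnit p))
      (volume.restrict sphBox) := by
    have hKt : ContinuousOn (fun y : E3 ↦ K t y) (sphere ξ R) := fun y hy ↦
      (ContinuousAt.comp (f := fun y : E3 ↦ (t, y)) (hKc.continuousAt (hW.mem_nhds (hsub y hy)))
        (continuousAt_const.prodMk continuousAt_id)).continuousWithinAt
    obtain ⟨M₀, hM₀⟩ := (isCompact_sphere ξ R).exists_bound_of_continuousOn hKt
    refine Measure.integrableOn_of_bounded volume_sphBox_lt_top.ne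
      (hFc t (mem_ball_self (by linarith))).aestronglyMeasurable (M := R ^ 2 * M₀)
      ((ae_restrict_iff' measurableSet_sphBox).mpr (Eventually.of_forall fun p _ ↦ ?_))
    rw [norm_mul]
    exact mul_le_mul (hw p) (hM₀ _ (add_smul_sphUnit_mem_sphere ξ hR.le p)) (norm_nonneg _)
      (sq_nonneg R)
  have hmeas' : AEStronglyMeasurable (fun p : E2 ↦
      (R ^ 2 * sin (p 0)) * fderiv ℝ (Function.uncurry K) (t, ξ + R • sphUnit p) (1, 0))
      (volume.restrict sphBox) := hF'c.aestronglyMeasurable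
  have hbound : ∀ᵐ p ∂(volume.restrict sphBox), ∀ s ∈ ball t (ε / 2),
      ‖(R ^ 2 * sin (p 0)) * fderiv ℝ (Function.uncurry K) (s, ξ + R • sphUnit p) (1, 0)‖ ≤
        R ^ 2 * M := by
    refine Eventually.of_forall fun p s hs ↦ ?_
    rw [norm_mul]
    have hb := hM (s, ξ + R • sphUnit p)
      ⟨ball_subset_closedBall hs, add_smul_sphUnit_mem_sphere ξ hR.le p⟩
    have h2 : ‖fderiv ℝ (Function.uncurry K) (s, ξ + R • sphUnit p) (1, 0)‖ ≤ M := by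
      refine (ContinuousLinearMap.le_opNorm _ _).trans ?_
      have hn : ‖((1 : ℝ), (0 : E3))‖ ≤ 1 := by simp [Prod.norm_def]
      calc ‖fderiv ℝ (Function.uncurry K) (s, ξ + R • sphUnit p)‖ * ‖((1 : ℝ), (0 : E3))‖
          ≤ M * 1 := mul_le_mul hb hn (norm_nonneg _) hM0
        _ = M := mul_one M
    exact mul_le_mul (hw p) h2 (norm_nonneg _) (sq_nonneg R)
  have hbint : Integrable (fun _ : E2 ↦ R ^ 2 * M) (volume.restrict sphBox) :=
    integrableOn_const volume_sphBox_lt_top.ne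
  have hdiff : ∀ᵐ p ∂(volume.restrict sphBox), ∀ s ∈ ball t (ε / 2),
      HasDerivAt (fun s' ↦ (R ^ 2 * sin (p 0)) * K s' (ξ + R • sphUnit p))
        ((R ^ 2 * sin (p 0)) * fderiv ℝ (Function.uncurry K) (s, ξ + R • sphUnit p) (1, 0)) s := by
    refine Eventually.of_forall fun p s hs ↦ ?_
    have hmem := hmemW s hs p
    have hdf : HasFDerivAt (Function.uncurry K)
        (fderiv ℝ (Function.uncurry K) (s, ξ + R • sphUnit p)) (s, ξ + R • sphUnit p) :=
      ((hK.differentiableOn one_ne_zero _ hmem).differentiableAt (hW.mem_nhds hmem)).hasFDerivAt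
    have hpath : HasDerivAt (fun s' : ℝ ↦ (s', ξ + R • sphUnit p)) ((1 : ℝ), (0 : E3)) s :=
      (hasDerivAt_id s).prodMk (hasDerivAt_const s _)
    exact (hdf.comp_hasDerivAt s hpath).const_mul (R ^ 2 * sin (p 0))
  have hmain := (hasDerivAt_integral_of_dominated_loc_of_deriv_le hball hmeas hint hmeas' hbound
    hbint hdiff).2
  -- transport back to the sphere
  have hfun : (fun s ↦ ∫ y in sphere ξ R, K s y ∂(μHE[2] : Measure E3)) =
      fun s ↦ ∫ p in sphBox, (R ^ 2 * sin (p 0)) * K s (ξ + R • sphUnit p) := by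
    funext s
    exact setIntegral_sphere_center ξ hR (K s)
  rw [hfun, setIntegral_sphere_center ξ hR]
  exact hmain

end LLSphere

end Summit.FinalStateConjecture.FinalStateConjecture.Theorems

end
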